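import Mathlib.Analysis.Convex.Deriv
import Mathlib.Analysis.Calculus.Deriv.Slope
import Mathlib.Topology.Algebra.Order.LiminfLimsup
import HarnessLib

/-!
# Griffiths' lemma with differentiability only at the point; convexity of pointwise limits

Companion of `Literature/Analysis/Convex/PointwiseLimitDeriv.lean` (Griffiths' lemma,
`Literature.Analysis.Convex.tendsto_deriv_of_convexOn_of_tendsto`: if differentiable convex `f N : ℝ → ℝ`
converge pointwise to `g`, differentiable at `t₀`, then `deriv (f N) t₀ → deriv g t₀`; Griffiths 1964;
Ruelle, *Statistical Mechanics* (1969), §5.4). Two supplements used when the lemma is iterated (derivatives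
of limits of limits of convex functions, e.g. one-point functions along a family of infinite-volume
pressures):

* `convexOn_univ_of_tendsto` — a pointwise limit of convex functions on `ℝ` is convex;
* `tendsto_deriv_of_convexOn_of_tendsto_of_differentiableAt` — Griffiths' lemma assuming the approximants
  `f N` differentiable only AT `t₀` (a pointwise limit of convex functions is convex but in general not
  differentiable everywhere, so the everywhere-differentiable form does not iterate). The proof is the
  one of the companion file verbatim: the two secant inequalities of a convex function differentiable at
  `t₀`, `slope (f N) (t₀ - h) t₀ ≤ (f N)' t₀ ≤ slope (f N) t₀ (t₀ + h)`, only use the derivative at `t₀`.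
-/

namespace Literature.Analysis.Convex

open Filter Set Topology

/-- A pointwise limit of convex functions on `ℝ` is convex (pass to the limit in the convexity
inequality). [folklore] -/
theorem convexOn_univ_of_tendsto {f : ℕ → ℝ → ℝ} {g : ℝ → ℝ}
    (hfc : ∀ N, ConvexOn ℝ univ (f N)) (hlim : ∀ t, Tendsto (fun N => f N t) atTop (𝓝 (g t))) :
    ConvexOn ℝ univ g := by
  refine ⟨convex_univ, fun x _ y _ a b ha hb hab => ?_⟩
  refine le_of_tendsto_of_tendsto' (hlim (a • x + b • y))
    (((hlim x).const_smul a).add ((hlim y).const_smul b)) fun N => ?_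
  exact (hfc N).2 (mem_univ x) (mem_univ y) ha hb hab

/-- **Griffiths' lemma**, form with differentiability of the approximants only at the point. Pointwise
limits of convex functions on `ℝ`, each differentiable at `t₀`: if the limit is differentiable at `t₀`,
the derivatives at `t₀` converge to the derivative of the limit. [cite: Ruelle1969, §5.4 (Griffiths' lemma)] -/
theorem tendsto_deriv_of_convexOn_of_tendsto_of_differentiableAt {f : ℕ → ℝ → ℝ} {g : ℝ → ℝ}
    (hfc : ∀ N, ConvexOn ℝ univ (f N)) {t₀ : ℝ} (hfd : ∀ N, DifferentiableAt ℝ (f N) t₀)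
    (hlim : ∀ t, Tendsto (fun N => f N t) atTop (𝓝 (g t))) (hg : DifferentiableAt ℝ g t₀) :
    Tendsto (fun N => deriv (f N) t₀) atTop (𝓝 (deriv g t₀)) := by
  -- adapted from Literature/Analysis/Convex/PointwiseLimitDeriv.lean (differentiability only at `t₀`)
  have hslope : ∀ h : ℝ, Tendsto (fun N => h⁻¹ • (f N (t₀ + h) - f N t₀)) atTop
      (𝓝 (h⁻¹ • (g (t₀ + h) - g t₀))) := fun h =>
    ((hlim (t₀ + h)).sub (hlim t₀)).const_smul h⁻¹
  have hR := hg.hasDerivAt.tendsto_slope_zero_right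
  have hL := hg.hasDerivAt.tendsto_slope_zero_left
  rw [tendsto_order]
  constructor
  · -- lower bound: `deriv g t₀ - ε < deriv (f N) t₀` eventually, through a left secant
    intro a ha
    obtain ⟨h, hh, hneg⟩ : ∃ h : ℝ, a < h⁻¹ • (g (t₀ + h) - g t₀) ∧ h < 0 := by
      have hev : ∀ᶠ h in 𝓝[<] (0 : ℝ), a < h⁻¹ • (g (t₀ + h) - g t₀) := hL (Ioi_mem_nhds ha)
      exact (hev.and self_mem_nhdsWithin).exists
    have hev : ∀ᶠ N in atTop, a < h⁻¹ • (f N (t₀ + h) - f N t₀) := hslope h (Ioi_mem_nhds hh)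
    refine hev.mono fun N hN => lt_of_lt_of_le hN ?_
    have hsl : h⁻¹ • (f N (t₀ + h) - f N t₀) = slope (f N) (t₀ + h) t₀ := by
      rw [slope_def_field, smul_eq_mul, show t₀ - (t₀ + h) = -h by ring, div_neg, ← neg_div, neg_sub,
        div_eq_inv_mul]
    rw [hsl]
    exact (hfc N).slope_le_deriv (mem_univ _) (mem_univ _) (by linarith) (hfd N)
  · -- upper bound: `deriv (f N) t₀ < deriv g t₀ + ε` eventually, through a right secant
    intro b hb
    obtain ⟨h, hh, hpos⟩ : ∃ h : ℝ, h⁻¹ • (g (t₀ + h) - g t₀) < b ∧ 0 < h := by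
      have hev : ∀ᶠ h in 𝓝[>] (0 : ℝ), h⁻¹ • (g (t₀ + h) - g t₀) < b := hR (Iio_mem_nhds hb)
      exact (hev.and self_mem_nhdsWithin).exists
    have hev : ∀ᶠ N in atTop, h⁻¹ • (f N (t₀ + h) - f N t₀) < b := hslope h (Iio_mem_nhds hh)
    refine hev.mono fun N hN => lt_of_le_of_lt ?_ hN
    have hsl : h⁻¹ • (f N (t₀ + h) - f N t₀) = slope (f N) t₀ (t₀ + h) := by
      rw [slope_def_field, smul_eq_mul, show t₀ + h - t₀ = h by ring, div_eq_inv_mul]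
    rw [hsl]
    exact (hfc N).deriv_le_slope (mem_univ _) (mem_univ _) (by linarith) (hfd N)

end Literature.Analysis.Convex
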